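import Summits.KontsevichZagierPeriods.KontsevichZagierPeriods.Theorems.SoloBlindSector
import Mathlib.RingTheory.Nilpotent.Basic
import Mathlib.Algebra.Polynomial.Div
import HarnessLib

/-!
# The summit statement as three independent conjuncts: reducedness, cancellation, transcendence

`Q` is the formal period ring (formal `ℤ`-combinations of integral representations modulo the
three rules of the Kontsevich–Zagier calculus, `SoloBlindBoxRing`), a commutative `K₀`-algebra over
the field `K₀` of real algebraic numbers, and `evalQ : Q →+* ℝ` is the period map. The summit
statement `Literature.Periods.KZPeriodConjecture` follows from the injectivity of `evalQ`
(`SoloBlind.kz_of_injective_evalQ`); `SoloBlind.injective_evalQ_iff_transcendental` split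
injectivity as `(D) Q has no zero-divisors ∧ (T) formally transcendental classes have
transcendental periods`.

This file sharpens the algebraic half `(D)`. Injectivity of `evalQ` is equivalent to the
conjunction of three statements, each of which is necessary, and which are mutually independent
for an abstract `K₀`-algebra with a `K₀`-algebra map to `ℝ`:

* `(R)` **reducedness**: `Q` has no non-zero nilpotents — at the level of representations: if the
  self-product `∫_{σ×σ} f(x) f(y)` of a representation can be moved to the empty integral by the
  three rules, then so can `∫_σ f` (`SoloBlind.isReduced_iff_rep`);
* `(C)` **cancellation by classes of non-zero period**: `evalQ y ≠ 0 ∧ x * y = 0 → x = 0` — at the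
  level of representations: if `∫_τ g ≠ 0` and `∫_{σ×τ} f ⊗ g` can be moved to the empty integral,
  then so can `∫_σ f` (`SoloBlind.cancel_iff_rep`);
* `(T)` **transcendence**: a class which satisfies no polynomial equation over `K₀` in `Q` has a
  transcendental period.

Main results:

* `SoloBlind.injective_evalQ_iff_reduced_cancel` : `Injective evalQ ↔ (R) ∧ (C) ∧ (T)`;
* `SoloBlind.evalQ_eq_zero_iff_isNilpotent` : under `(C) ∧ (T)` alone the kernel of the period map
  is exactly the nilradical of `Q` — every formal combination of period zero is nilpotent;
* `SoloBlind.kz_of_reduced_cancel_transcendental` : `(R) → (C) → (T) → KZPeriodConjecture`;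
* `SoloBlind.exists_rep_mkQ_eq` : every class of `Q` is the class of a single representation
  (so the representation-level readings above are faithful);
* `SoloBlind.isReduced_iff_rep`, `SoloBlind.cancel_iff_rep`, `SoloBlind.transcendence_iff_rep` :
  the three conjuncts read on single integral representations.

Independence of the three conjuncts (for abstract `K₀`-algebras `A → ℝ`, not formalised here):
`K₀ × K₀ → ℝ` (first projection) satisfies `(R)`, `(T)` and not `(C)`; `K₀[ε]/(ε²) → ℝ`, `ε ↦ 0`
satisfies `(C)`, `(T)` and not `(R)`; `K₀[t] → ℝ`, `t ↦ 0` satisfies `(R)`, `(C)` and not `(T)`.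
So none of the three can be dropped from the equivalence.

The point of the split: `(R)` and `(C)` carry no transcendence content. `(R)` is a statement
about the geometry of the affine `K₀`-scheme `Spec Q`; `(C)` only asks for the *non-vanishing* of a
period, never for its irrationality. In the literature on the Grothendieck/Kontsevich–Zagier
conjecture the analogous statements for the algebra of formal (Nori) periods are, respectively,
the reducedness of the period torsor (automatic in characteristic zero, Cartier) together with the
injectivity of effective into all formal periods, and the integrality of the formal period algebra,
equivalently the connectedness of the motivic Galois group (Huber–Müller-Stach, *Periods and Nori
motives*, Remark 13.2.2, Remark 9.5.7, Corollary 13.2.7; Huber–Wüstholz, *Transcendence and linear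
relations of 1-periods*, Appendix A.3–A.4). The present file is self-contained and uses none of this.
-/

namespace Summit.KontsevichZagierPeriods.KontsevichZagierPeriods.Theorems

open Literature.NumberTheory.Transcendental
open Literature.NumberTheory.Transcendental.KZ

namespace SoloBlind

/-! ## The three conjuncts are necessary -/

/-- `(R)` from injectivity: the formal period ring is reduced. -/
theorem isReduced_of_injective_evalQ (h : Function.Injective evalQ) : IsReduced Q :=
  isReduced_of_injective evalQ h

/-- `(C)` from injectivity: a class of non-zero period is not a zero-divisor. -/
theorem cancel_of_injective_evalQ (h : Function.Injective evalQ) {x y : Q} (hy : evalQ y ≠ 0)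
    (hxy : x * y = 0) : x = 0 := by
  have h1 : evalQ x * evalQ y = 0 := by rw [← map_mul, hxy, map_zero]
  exact (injective_iff_map_eq_zero evalQ).mp h x ((mul_eq_zero.mp h1).resolve_right hy)

/-- `(T)` from injectivity: a formally transcendental class has a transcendental period. -/
theorem transcendental_of_injective_evalQ (h : Function.Injective evalQ) {x : Q}
    (hx : Transcendental K₀ x) : Transcendental K₀ (evalQ x) :=
  (injective_evalQ_iff_transcendental.mp h).2 x hx

/-! ## Under `(C)`, an algebraic class of period zero is nilpotent -/

/-- **Key lemma.** Assume `(C)`. If `x : Q` is algebraic over `K₀` and has period `0`, then `x`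
is nilpotent: write the annihilating polynomial as `X ^ k * P₁` with `P₁ 0 ≠ 0`; the class
`P₁ x` has period `P₁ 0 ≠ 0` and `x ^ k * P₁ x = 0`, so `(C)` cancels it. -/
theorem isNilpotent_of_isAlgebraic_of_evalQ
    (hC : ∀ x y : Q, evalQ y ≠ 0 → x * y = 0 → x = 0) {x : Q} (hx : IsAlgebraic K₀ x)
    (h0 : evalQ x = 0) : IsNilpotent x := by
  obtain ⟨P, hP0, hPx⟩ := hx
  obtain ⟨P₁, hP, hndvd⟩ := P.exists_eq_pow_rootMultiplicity_mul_and_not_dvd hP0 0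
  simp only [map_zero, sub_zero] at hP hndvd
  rw [Polynomial.X_dvd_iff] at hndvd
  refine ⟨P.rootMultiplicity 0, hC _ (Polynomial.aeval x P₁) ?_ ?_⟩
  · intro h
    apply hndvd
    rw [← evalAlgHom_apply, ← Polynomial.aeval_algHom_apply, evalAlgHom_apply, h0,
      ← Polynomial.coeff_zero_eq_aeval_zero'] at h
    exact (map_eq_zero_iff _ (algebraMap K₀ ℝ).injective).mp h
  · have h1 : Polynomial.aeval x ((Polynomial.X : Polynomial K₀) ^ P.rootMultiplicity 0 * P₁) = 0 := by
      rw [← hP]; exact hPx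
    rwa [map_mul, map_pow, Polynomial.aeval_X] at h1

/-- Under `(C) ∧ (T)` **the kernel of the period map is the nilradical**: a class has period `0`
iff it is nilpotent. -/
theorem evalQ_eq_zero_iff_isNilpotent
    (hC : ∀ x y : Q, evalQ y ≠ 0 → x * y = 0 → x = 0)
    (hT : ∀ x : Q, Transcendental K₀ x → Transcendental K₀ (evalQ x)) (x : Q) :
    evalQ x = 0 ↔ IsNilpotent x := by
  refine ⟨fun h0 => ?_, fun h => (h.map evalQ).eq_zero⟩
  have halg : IsAlgebraic K₀ x := by
    by_contra htr
    exact hT x htr (h0 ▸ isAlgebraic_zero)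
  exact isNilpotent_of_isAlgebraic_of_evalQ hC halg h0

/-! ## The equivalence and the summit statement -/

/-- **Injectivity of the period map ⟺ `(R)` reduced ∧ `(C)` cancellation by classes of non-zero
period ∧ `(T)` transcendence.** -/
theorem injective_evalQ_iff_reduced_cancel :
    Function.Injective evalQ ↔ IsReduced Q ∧ (∀ x y : Q, evalQ y ≠ 0 → x * y = 0 → x = 0) ∧
      ∀ x : Q, Transcendental K₀ x → Transcendental K₀ (evalQ x) := by
  refine ⟨fun h => ⟨isReduced_of_injective_evalQ h, fun _ _ hy hxy => cancel_of_injective_evalQ h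
    hy hxy, fun _ hx => transcendental_of_injective_evalQ h hx⟩, fun ⟨hR, hC, hT⟩ => ?_⟩
  rw [injective_iff_map_eq_zero]
  intro x hx
  exact ((evalQ_eq_zero_iff_isNilpotent hC hT x).mp hx).eq_zero

/-- `(R) ∧ (C)` is exactly `(D)` *given* `(T)`: under transcendence, "reduced with cancellation by
classes of non-zero period" is the same as "no zero-divisors". -/
theorem noZeroDivisors_iff_reduced_cancel
    (hT : ∀ x : Q, Transcendental K₀ x → Transcendental K₀ (evalQ x)) :
    NoZeroDivisors Q ↔ IsReduced Q ∧ ∀ x y : Q, evalQ y ≠ 0 → x * y = 0 → x = 0 := by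
  constructor
  · intro hD
    have h := injective_evalQ_iff_transcendental.mpr ⟨hD, hT⟩
    exact ⟨isReduced_of_injective_evalQ h, fun _ _ hy hxy => cancel_of_injective_evalQ h hy hxy⟩
  · rintro ⟨hR, hC⟩
    exact noZeroDivisors_of_injective_evalQ
      (injective_evalQ_iff_reduced_cancel.mpr ⟨hR, hC, hT⟩)

/-- **The summit statement from `(R)`, `(C)` and `(T)`.** -/
theorem kz_of_reduced_cancel_transcendental (hR : IsReduced Q)
    (hC : ∀ x y : Q, evalQ y ≠ 0 → x * y = 0 → x = 0)
    (hT : ∀ x : Q, Transcendental K₀ x → Transcendental K₀ (evalQ x)) :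
    Literature.Periods.KZPeriodConjecture :=
  kz_of_injective_evalQ (injective_evalQ_iff_reduced_cancel.mpr ⟨hR, hC, hT⟩)

/-! ## Every class is the class of one representation -/

/-- `[σ, f] + [σ, −f]` is a relation. -/
theorem of_add_of_neg_mem_relations {n : ℕ} (r : IntegralRep n) :
    of r + of r.neg ∈ relations :=
  of_add_of_mem_relations_of_neg rfl fun _ _ => rfl

/-- **Every element of `Q` is the class of a single integral representation**: a formal
`ℤ`-combination is a difference `[r] − [r']` modulo the rules (`KZ.exists_integralRep_sub_holds`),
`−[r'] ≡ [r'.neg]`, and two representations merge into one (disjoint slabs in a common dimension,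
`IntegralRep.exists_of_add_of_sub_of_mem_relations`). -/
theorem exists_rep_mkQ_eq (x : Q) : ∃ (N : ℕ) (R : IntegralRep N), mkQ (of R) = x := by
  obtain ⟨z, rfl⟩ := mkQ_surjective x
  obtain ⟨n, m, r, r', h⟩ := exists_integralRep_sub_holds z
  obtain ⟨N, R, hR⟩ := r.exists_of_add_of_sub_of_mem_relations r'.neg
  refine ⟨N, R, (mkQ_eq_mkQ_iff.mpr ?_).symm⟩
  have : z - of R = (z - (of r - of r')) + (of r + of r'.neg - of R) - (of r' + of r'.neg) := by
    abel
  rw [this]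
  exact relations.sub_mem (relations.add_mem h hR) (of_add_of_neg_mem_relations r')

/-- The class of a product representation is the product of the classes. -/
theorem mkQ_of_prod {n m : ℕ} (r : IntegralRep n) (s : IntegralRep m) :
    mkQ (of (r.prod s)) = mkQ (of r) * mkQ (of s) := by
  rw [← mkQ_mul, of_mul_of]

/-! ## The three conjuncts read on single representations -/

/-- `(R)` **on representations**: `Q` is reduced iff for every integral representation `R`, if the
self-product `R × R` (domain `σ × σ`, integrand `f(x) f(y)`) can be moved to the empty integral by
the three rules, then so can `R`. -/
theorem isReduced_iff_rep :
    IsReduced Q ↔ ∀ (N : ℕ) (R : IntegralRep N), of (R.prod R) ∈ relations → of R ∈ relations := by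
  rw [isReduced_iff_pow_one_lt 2 one_lt_two]
  refine ⟨fun h N R hRR => ?_, fun h x hx => ?_⟩
  · rw [← mkQ_eq_zero_iff] at hRR ⊢
    exact h _ (by rw [pow_two, ← mkQ_of_prod, hRR])
  · obtain ⟨N, R, rfl⟩ := exists_rep_mkQ_eq x
    rw [pow_two, ← mkQ_of_prod, mkQ_eq_zero_iff] at hx
    exact mkQ_eq_zero_iff.mpr (h N R hx)

/-- `(C)` **on representations**: cancellation holds iff for all representations `r`, `s` with
`∫ s ≠ 0`, if `r × s` can be moved to the empty integral then so can `r`. Only the non-vanishing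
of the period of `s` enters. -/
theorem cancel_iff_rep :
    (∀ x y : Q, evalQ y ≠ 0 → x * y = 0 → x = 0) ↔
      ∀ (n m : ℕ) (r : IntegralRep n) (s : IntegralRep m), s.value ≠ 0 →
        of (r.prod s) ∈ relations → of r ∈ relations := by
  refine ⟨fun h n m r s hs hrs => ?_, fun h x y hy hxy => ?_⟩
  · rw [← mkQ_eq_zero_iff] at hrs ⊢
    exact h _ (mkQ (of s)) (by rwa [evalQ_mkQ, eval_of]) (by rw [← mkQ_of_prod, hrs])
  · obtain ⟨n, r, rfl⟩ := exists_rep_mkQ_eq x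
    obtain ⟨m, s, rfl⟩ := exists_rep_mkQ_eq y
    rw [evalQ_mkQ, eval_of] at hy
    rw [← mkQ_of_prod, mkQ_eq_zero_iff] at hxy
    exact mkQ_eq_zero_iff.mpr (h n m r s hy hxy)

/-- `(T)` **on representations**: transcendence transfer holds iff every representation whose
period is algebraic (over `K₀`, equivalently over `ℚ`) has a class which is algebraic over `K₀`
in `Q`, i.e. some non-trivial `K₀`-polynomial in `R, R × R, R × R × R, …` is a relation. -/
theorem transcendence_iff_rep :
    (∀ x : Q, Transcendental K₀ x → Transcendental K₀ (evalQ x)) ↔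
      ∀ (N : ℕ) (R : IntegralRep N), IsAlgebraic K₀ R.value → IsAlgebraic K₀ (mkQ (of R)) := by
  refine ⟨fun h N R hR => ?_, fun h x hx halg => ?_⟩
  · by_contra htr
    exact h _ htr (by rwa [evalQ_mkQ, eval_of])
  · obtain ⟨N, R, rfl⟩ := exists_rep_mkQ_eq x
    rw [evalQ_mkQ, eval_of] at halg
    exact hx (h N R halg)

/-- **The summit statement from the three conjuncts in representation form.** -/
theorem kz_of_rep_conjuncts
    (hR : ∀ (N : ℕ) (R : IntegralRep N), of (R.prod R) ∈ relations → of R ∈ relations)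
    (hC : ∀ (n m : ℕ) (r : IntegralRep n) (s : IntegralRep m), s.value ≠ 0 →
      of (r.prod s) ∈ relations → of r ∈ relations)
    (hT : ∀ (N : ℕ) (R : IntegralRep N), IsAlgebraic K₀ R.value → IsAlgebraic K₀ (mkQ (of R))) :
    Literature.Periods.KZPeriodConjecture :=
  kz_of_reduced_cancel_transcendental (isReduced_iff_rep.mpr hR) (cancel_iff_rep.mpr hC)
    (transcendence_iff_rep.mpr hT)

end SoloBlind

end Summit.KontsevichZagierPeriods.KontsevichZagierPeriods.Theorems
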